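import Literature.MathematicalPhysics.QuantumLattice.DuhamelTwoPoint
import Mathlib.Analysis.CStarAlgebra.Matrix
import Mathlib.Analysis.Normed.Algebra.MatrixExponential
import Mathlib.Analysis.SpecialFunctions.Exponential
import Mathlib.Analysis.SpecialFunctions.ExpDeriv
import Mathlib.Analysis.Calculus.DerivativeTest
import Mathlib.Analysis.Calculus.Deriv.Mul
import Mathlib.Analysis.Calculus.Deriv.Comp
import Mathlib.Analysis.Calculus.Deriv.Slope
import HarnessLib

/-!
# Gaussian domination implies the Duhamel infrared bound (discharge of DLS (44))

Trunk T-QLATTICE; sibling proof file of `DuhamelTwoPoint.lean`. No statement is introduced or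
changed; this file **discharges the named fact** `Matrix.gaussianDomination_duhamel_le`
(`Matrix.gaussianDomination_duhamel_le_holds`): if `H`, `V` are Hermitian, `β > 0`, `Q` real and
`Z_β(H - tV + ½t²Q) ≤ Z_β(H)` for all real `t`, then `(V, V)_{β,H} ≤ Q/β` ([DLS1978] eq. (44):
"Taking `hᵢ → λhᵢ` in (43), subtracting 1 from both sides, dividing by `λ²`, and taking `λ` to
zero"; [LSSY2005] after (11.12): "The infrared bound then follows from
`d²Z(εh)/dε²|_{ε=0} ≤ 0`").

## The proof

* **Duhamel's formula** for the matrix exponential,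
  `e^{A+B} = e^{A} + ∫₀¹ e^{s(A+B)} B e^{(1-s)A} ds` (`Matrix.exp_add_eq_exp_add_integral`), by the
  fundamental theorem of calculus for `s ↦ e^{s(A+B)}e^{(1-s)A}` (Mathlib
  `hasDerivAt_exp_smul_const`), whence the derivative of `t ↦ e^{A+tY}`
  (`Matrix.hasDerivAt_exp_add_smul`, the difference quotient being a parametric integral,
  continuous in `t`) and, by cyclicity of the trace, **`d/dt tr e^{A+tY} = tr(Y e^{A+tY})`** and
  **`d/dt tr(Y e^{A+tY}) = ∫₀¹ tr(Y e^{s(A+tY)} Y e^{(1-s)(A+tY)}) ds`**; at `t = 0`, with `A = -βH`,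
  `Y = βV`, the latter is `β² Z (V,V)`.
* With `f(t) = tr e^{-β(H-tV)}` the hypothesis reads `g(t) = e^{-βt²Q/2} f(t) ≤ g(0)`; `g` is
  differentiable with `g'` differentiable at `0` and `g''(0) = -βQ Z + β²Z(V,V)`. If `g''(0) > 0`
  the second-derivative test (Mathlib `isLocalMin_of_deriv_deriv_pos`) would make `0` a local
  minimum as well, so `g` would be locally constant and `g''(0) = 0`: contradiction. Hence
  `β²Z(V,V) ≤ βQZ`.

## References

* [DLS1978] F. J. Dyson, E. H. Lieb, B. Simon, J. Stat. Phys. 18 (1978) 335–383, §4, eq. (44).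
* [LSSY2005] E. H. Lieb, R. Seiringer, J. P. Solovej, J. Yngvason, *The Mathematics of the Bose
  Gas and its Condensation* (2005), Ch. 11, (11.8)–(11.12).

## Design notes

The `L2Operator` matrix norm scope of `FinDimSpectrum.lean`/`DuhamelTwoPoint.lean` is used for the
calculus (its algebraic structure is definitionally the default one of `Matrix`); `NormedSpace.exp`
does not depend on the norm. Real parameters act on complex matrices through
`Module.complexToReal` (`t • Y = (t : ℂ) • Y`, `Complex.coe_smul`).
-/

noncomputable section

open scoped Matrix.Norms.L2Operator ComplexOrder
open Finset MeasureTheory intervalIntegral Filter Topology NormedSpace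

namespace Matrix

variable {m : Type*} [Fintype m] [DecidableEq m]

/-! ### Duhamel's formula for the matrix exponential -/

/-- The derivative of `s ↦ e^{s(A+B)} e^{(1-s)A}` is `e^{s(A+B)} B e^{(1-s)A}`. [folklore] -/
theorem hasDerivAt_exp_smul_mul_exp (A B : Matrix m m ℂ) (s : ℝ) :
    HasDerivAt (fun u : ℝ => exp (u • (A + B)) * exp ((1 - u) • A))
      (exp (s • (A + B)) * B * exp ((1 - s) • A)) s := by
  have h1 : HasDerivAt (fun u : ℝ => exp (u • (A + B))) (exp (s • (A + B)) * (A + B)) s :=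
    hasDerivAt_exp_smul_const (A + B) s
  have h2 : HasDerivAt (fun u : ℝ => exp ((1 - u) • A)) (-(A * exp ((1 - s) • A))) s := by
    have h := (hasDerivAt_exp_smul_const' A (1 - s)).scomp s
      ((hasDerivAt_const s (1 : ℝ)).sub (hasDerivAt_id s))
    simpa [Function.comp_def] using h
  refine (h1.fun_mul h2).congr_deriv ?_
  simp only [mul_add, add_mul, mul_neg, mul_assoc]
  abel

/-- The Duhamel integrands `s ↦ e^{sA} B e^{(1-s)C}` are continuous. [folklore] -/
theorem continuous_exp_smul_mul_mul_exp (A B C : Matrix m m ℂ) :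
    Continuous fun s : ℝ => exp (s • A) * B * exp ((1 - s) • C) := by
  letI : NormedAlgebra ℚ (Matrix m m ℂ) := .restrictScalars ℚ ℂ _
  fun_prop

/-- **Duhamel's formula**: `e^{A+B} = e^{A} + ∫₀¹ e^{s(A+B)} B e^{(1-s)A} ds` for square complex
matrices (fundamental theorem of calculus for `s ↦ e^{s(A+B)}e^{(1-s)A}`).
[cite: DLS1978, eq. (5)] -/
theorem exp_add_eq_exp_add_integral (A B : Matrix m m ℂ) :
    exp (A + B) = exp A + ∫ s in (0:ℝ)..1, exp (s • (A + B)) * B * exp ((1 - s) • A) := by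
  have h := intervalIntegral.integral_eq_sub_of_hasDerivAt
    (fun s _ => hasDerivAt_exp_smul_mul_exp A B s)
    ((continuous_exp_smul_mul_mul_exp (A + B) B A).intervalIntegrable 0 1)
  simp only [one_smul, sub_self, zero_smul, exp_zero, mul_one, one_mul, sub_zero] at h
  rw [h]
  abel

/-- The increment of `t ↦ e^{A+tY}`:
`e^{A+(t₀+t)Y} - e^{A+t₀Y} = t ∫₀¹ e^{s(A+(t₀+t)Y)} Y e^{(1-s)(A+t₀Y)} ds`. [cite: DLS1978, eq. (5)] -/
theorem exp_add_smul_sub (A Y : Matrix m m ℂ) (t₀ t : ℝ) :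
    exp (A + (t₀ + t) • Y) - exp (A + t₀ • Y) =
      t • ∫ s in (0:ℝ)..1, exp (s • (A + (t₀ + t) • Y)) * Y * exp ((1 - s) • (A + t₀ • Y)) := by
  have h := exp_add_eq_exp_add_integral (A + t₀ • Y) (t • Y)
  have e : A + t₀ • Y + t • Y = A + (t₀ + t) • Y := by rw [add_smul, add_assoc]
  rw [e] at h
  rw [h, add_sub_cancel_left, ← intervalIntegral.integral_smul]
  congr 1
  funext s
  rw [mul_smul_comm, smul_mul_assoc]

/-- The difference quotient of `t ↦ e^{A+tY}` at `t₀` is a parametric integral, continuous in the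
increment. [folklore] -/
theorem continuous_duhamel_increment (A Y Z : Matrix m m ℂ) (t₀ : ℝ) :
    Continuous fun t : ℝ =>
      ∫ s in (0:ℝ)..1, exp (s • (A + (t₀ + t) • Y)) * Y * exp ((1 - s) • Z) := by
  letI : NormedAlgebra ℚ (Matrix m m ℂ) := .restrictScalars ℚ ℂ _
  refine intervalIntegral.continuous_parametric_intervalIntegral_of_continuous' ?_ 0 1
  show Continuous fun p : ℝ × ℝ => exp (p.2 • (A + (t₀ + p.1) • Y)) * Y * exp ((1 - p.2) • Z)
  fun_prop

/-- **The derivative of `t ↦ e^{A+tY}`** (first-order Duhamel perturbation formula):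
`d/dt e^{A+tY} = ∫₀¹ e^{s(A+tY)} Y e^{(1-s)(A+tY)} ds`. [cite: DLS1978, eq. (5)] -/
theorem hasDerivAt_exp_add_smul (A Y : Matrix m m ℂ) (t₀ : ℝ) :
    HasDerivAt (fun t : ℝ => exp (A + t • Y))
      (∫ s in (0:ℝ)..1, exp (s • (A + t₀ • Y)) * Y * exp ((1 - s) • (A + t₀ • Y))) t₀ := by
  rw [hasDerivAt_iff_tendsto_slope_zero]
  set G : ℝ → Matrix m m ℂ := fun t =>
    ∫ s in (0:ℝ)..1, exp (s • (A + (t₀ + t) • Y)) * Y * exp ((1 - s) • (A + t₀ • Y)) with hG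
  have hGc : Continuous G := continuous_duhamel_increment A Y (A + t₀ • Y) t₀
  have hG0 : G 0 = ∫ s in (0:ℝ)..1, exp (s • (A + t₀ • Y)) * Y * exp ((1 - s) • (A + t₀ • Y)) := by
    simp only [hG, add_zero]
  rw [← hG0]
  refine ((hGc.tendsto 0).mono_left nhdsWithin_le_nhds).congr' ?_
  refine eventually_nhdsWithin_of_forall fun t ht => ?_
  show G t = t⁻¹ • (exp (A + (t₀ + t) • Y) - exp (A + t₀ • Y))
  rw [exp_add_smul_sub, inv_smul_smul₀ ht]

/-! ### Derivatives of traces -/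

/-- **`d/dt tr(C e^{A+tY}) = ∫₀¹ tr(C e^{s(A+tY)} Y e^{(1-s)(A+tY)}) ds`** for a fixed matrix `C`.
[cite: DLS1978, eq. (5)] -/
theorem hasDerivAt_trace_mul_exp_add_smul (C A Y : Matrix m m ℂ) (t₀ : ℝ) :
    HasDerivAt (fun t : ℝ => (C * exp (A + t • Y)).trace)
      (∫ s in (0:ℝ)..1,
        (C * (exp (s • (A + t₀ • Y)) * Y * exp ((1 - s) • (A + t₀ • Y)))).trace) t₀ := by
  set L : Matrix m m ℂ →L[ℝ] ℂ := LinearMap.toContinuousLinearMap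
    (((Matrix.traceLinearMap m ℂ ℂ) ∘ₗ (LinearMap.mulLeft ℂ C)).restrictScalars ℝ) with hL
  have hLapply : ∀ X : Matrix m m ℂ, L X = (C * X).trace := fun X => rfl
  have h := L.hasFDerivAt.comp_hasDerivAt t₀ (hasDerivAt_exp_add_smul A Y t₀)
  rw [← L.intervalIntegral_comp_comm
    ((continuous_exp_smul_mul_mul_exp _ Y _).intervalIntegrable 0 1)] at h
  simp only [hLapply] at h
  exact h

/-- **`d/dt tr e^{A+tY} = tr(Y e^{A+tY})`** (cyclicity of the trace collapses the Duhamel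
integral). [cite: DLS1978, §3] -/
theorem hasDerivAt_trace_exp_add_smul (A Y : Matrix m m ℂ) (t₀ : ℝ) :
    HasDerivAt (fun t : ℝ => (exp (A + t • Y)).trace) ((Y * exp (A + t₀ • Y)).trace) t₀ := by
  have h := hasDerivAt_trace_mul_exp_add_smul 1 A Y t₀
  simp only [Matrix.one_mul] at h
  refine h.congr_deriv ?_
  have key : ∀ s : ℝ, (exp (s • (A + t₀ • Y)) * Y * exp ((1 - s) • (A + t₀ • Y))).trace =
      (Y * exp (A + t₀ • Y)).trace := by
    intro s
    have hc : Commute ((1 - s) • (A + t₀ • Y)) (s • (A + t₀ • Y)) :=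
      ((Commute.refl (A + t₀ • Y)).smul_left _).smul_right _
    rw [Matrix.mul_assoc, trace_mul_comm, Matrix.mul_assoc, ← Matrix.exp_add_of_commute _ _ hc,
      ← add_smul, sub_add_cancel, one_smul]
  simp_rw [key]
  simp

/-- Real parts: `d/dt Re tr e^{A+tY} = Re tr(Y e^{A+tY})`. [folklore] -/
theorem hasDerivAt_re_trace_exp_add_smul (A Y : Matrix m m ℂ) (t₀ : ℝ) :
    HasDerivAt (fun t : ℝ => (exp (A + t • Y)).trace.re) ((Y * exp (A + t₀ • Y)).trace.re) t₀ := by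
  have h := Complex.reCLM.hasFDerivAt.comp_hasDerivAt t₀ (hasDerivAt_trace_exp_add_smul A Y t₀)
  rw [Complex.reCLM_apply] at h
  exact h.congr_of_eventuallyEq (Eventually.of_forall fun t => rfl)

/-- Real parts: `d/dt Re tr(Y e^{A+tY}) = Re ∫₀¹ tr(Y e^{s(A+tY)} Y e^{(1-s)(A+tY)}) ds`. [folklore] -/
theorem hasDerivAt_re_trace_mul_exp_add_smul (A Y : Matrix m m ℂ) (t₀ : ℝ) :
    HasDerivAt (fun t : ℝ => (Y * exp (A + t • Y)).trace.re)
      (∫ s in (0:ℝ)..1,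
        (Y * (exp (s • (A + t₀ • Y)) * Y * exp ((1 - s) • (A + t₀ • Y)))).trace).re t₀ := by
  have h := Complex.reCLM.hasFDerivAt.comp_hasDerivAt t₀
    (hasDerivAt_trace_mul_exp_add_smul Y A Y t₀)
  rw [Complex.reCLM_apply] at h
  exact h.congr_of_eventuallyEq (Eventually.of_forall fun t => rfl)

/-! ### The second-derivative argument -/

/-- **A global maximum with positive second derivative is impossible unless the second derivative
vanishes**: if `g ≤ g 0` everywhere, `g` is differentiable with `deriv g = g'`, and `g'` has
derivative `d` at `0`, then `d ≤ 0` (second-derivative test: `d > 0` would make `0` a local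
minimum, so `g` would be locally constant and `d = 0`). [folklore] -/
theorem deriv2_nonpos_of_forall_le {g g' : ℝ → ℝ} {d : ℝ} (hle : ∀ t, g t ≤ g 0)
    (hg : ∀ t, HasDerivAt g (g' t) t) (hg' : HasDerivAt g' d 0) : d ≤ 0 := by
  by_contra hpos
  push Not at hpos
  have hderiv : deriv g = g' := funext fun t => (hg t).deriv
  have hmax : IsLocalMax g 0 := Filter.Eventually.of_forall hle
  have hd0 : deriv g 0 = 0 := hmax.deriv_eq_zero
  have hdd : deriv (deriv g) 0 = d := by rw [hderiv]; exact hg'.deriv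
  have hmin : IsLocalMin g 0 :=
    isLocalMin_of_deriv_deriv_pos (by rw [hdd]; exact hpos) hd0 (hg 0).continuousAt
  have hconst : g =ᶠ[𝓝 0] fun _ => g 0 :=
    (show ∀ᶠ t in 𝓝 0, g 0 ≤ g t from hmin).mono fun t ht => le_antisymm (hle t) ht
  have hdz : deriv g =ᶠ[𝓝 0] fun _ => 0 := by
    have h2 : ∀ᶠ t in 𝓝 0, g =ᶠ[𝓝 t] fun _ => g 0 := eventually_eventuallyEq_nhds.2 hconst
    exact h2.mono fun t ht => by rw [ht.deriv_eq, deriv_const]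
  have hdd0 : deriv (deriv g) 0 = 0 := by rw [hdz.deriv_eq, deriv_const]
  linarith

/-! ### Discharge of `gaussianDomination_duhamel_le` -/

/-- The modified partition function factorises: with `A = -βH`, `Y = βV`,
`Z_β(H - tV + r·1) = e^{-βr} tr e^{A+tY}`. [cite: LSSY2005, Ch. 11 (11.10)–(11.12)] -/
theorem partitionFn_sub_smul_add_smul_one (β : ℝ) (H V : Matrix m m ℂ) (t r : ℝ) :
    partitionFn β (H - (t : ℂ) • V + (r : ℂ) • 1) =
      (Real.exp (-(β * r)) : ℂ) * (exp (-(β : ℂ) • H + t • ((β : ℂ) • V))).trace := by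
  have hsplit : -(β : ℂ) • (H - (t : ℂ) • V + (r : ℂ) • 1) =
      (-(β : ℂ) • H + t • ((β : ℂ) • V)) + ((-(β * r) : ℝ) : ℂ) • (1 : Matrix m m ℂ) := by
    rw [← Complex.coe_smul]
    push_cast
    module
  have hc : Commute (-(β : ℂ) • H + t • ((β : ℂ) • V)) (((-(β * r) : ℝ) : ℂ) • (1 : Matrix m m ℂ)) :=
    (Commute.one_right _).smul_right _
  rw [partitionFn, gibbsWeight, hsplit, Matrix.exp_add_of_commute _ _ hc,
    ← Algebra.algebraMap_eq_smul_one, ← algebraMap_exp_comm, ← Complex.exp_eq_exp_ℂ,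
    ← Complex.ofReal_exp, Algebra.algebraMap_eq_smul_one, Matrix.mul_smul, Matrix.mul_one,
    trace_smul, smul_eq_mul]

/-- The Gibbs weights along the Duhamel segment: `e^{s·(-βH)} = e^{-(sβ)H}`. [folklore] -/
theorem exp_smul_neg_smul_eq_gibbsWeight (β s : ℝ) (H : Matrix m m ℂ) :
    exp (s • (-(β : ℂ) • H)) = gibbsWeight (s * β) H := by
  rw [gibbsWeight, ← Complex.coe_smul, smul_smul]
  congr 1
  push_cast
  ring_nf

/-- **Discharge of the named fact `Matrix.gaussianDomination_duhamel_le`** ([DLS1978] eq. (44);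
[LSSY2005] after (11.12)): Gaussian domination `Z_β(H - tV + ½t²Q) ≤ Z_β(H)` for all real `t`
implies the infrared bound `(V, V)_{β,H} ≤ Q/β` for the Duhamel two-point function. Proof: the
second-order expansion of `t ↦ tr e^{-β(H-tV)}` at `t = 0` through the Duhamel formula
(`hasDerivAt_re_trace_exp_add_smul`, `hasDerivAt_re_trace_mul_exp_add_smul`) and the
second-derivative argument `deriv2_nonpos_of_forall_le` applied to `g(t) = e^{-βt²Q/2} tr e^{-β(H-tV)}`.
[cite: DLS1978, eq. (44)] [cite: LSSY2005, Ch. 11 (11.8)–(11.12)] -/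
theorem gaussianDomination_duhamel_le_holds : gaussianDomination_duhamel_le := by
  intro m _ _ _ β hβ H V hH hV Q hGD
  -- `A = -βH`, `Y = βV`, `f(t) = Re tr e^{A+tY}`
  set A : Matrix m m ℂ := -(β : ℂ) • H with hA
  set Y : Matrix m m ℂ := (β : ℂ) • V with hY
  set f : ℝ → ℝ := fun t => (exp (A + t • Y)).trace.re with hf
  set f' : ℝ → ℝ := fun t => (Y * exp (A + t • Y)).trace.re with hf'
  set I : ℂ := ∫ s in (0:ℝ)..1,
    (V * gibbsWeight (s * β) H * V * gibbsWeight ((1 - s) * β) H).trace with hI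
  have hfd : ∀ t, HasDerivAt f (f' t) t := fun t => hasDerivAt_re_trace_exp_add_smul A Y t
  -- the second derivative at `0` is `β² Re I`
  have hf'd : HasDerivAt f' (β ^ 2 * I.re) 0 := by
    have h := hasDerivAt_re_trace_mul_exp_add_smul A Y 0
    simp only [zero_smul, add_zero] at h
    refine h.congr_deriv ?_
    have key : ∀ s : ℝ, (Y * (exp (s • A) * Y * exp ((1 - s) • A))).trace =
        (β : ℂ) ^ 2 * (V * gibbsWeight (s * β) H * V * gibbsWeight ((1 - s) * β) H).trace := by
      intro s
      rw [hA, hY, exp_smul_neg_smul_eq_gibbsWeight, exp_smul_neg_smul_eq_gibbsWeight]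
      simp only [Matrix.smul_mul, Matrix.mul_smul, trace_smul, smul_eq_mul, Matrix.mul_assoc]
      ring
    simp_rw [key]
    rw [intervalIntegral.integral_const_mul, ← hI,
      show (β : ℂ) ^ 2 = ((β ^ 2 : ℝ) : ℂ) by push_cast; ring, Complex.re_ofReal_mul]
  -- the Gaussian factor `e(t) = exp(-c t²)`, `c = βQ/2`
  set c : ℝ := β * Q / 2 with hc
  set e : ℝ → ℝ := fun t => Real.exp (-(c * t ^ 2)) with he
  have hed : ∀ t, HasDerivAt e (e t * (-(c * (2 * t)))) t := by
    intro t
    have h1 : HasDerivAt (fun t : ℝ => -(c * t ^ 2)) (-(c * (2 * t))) t := by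
      have := ((hasDerivAt_pow 2 t).const_mul c).neg
      exact this.congr_deriv (by simp)
    exact h1.exp
  have he0 : e 0 = 1 := by simp [he]
  -- `g = e f ≤ g 0` by Gaussian domination
  set g : ℝ → ℝ := fun t => e t * f t with hg
  have hgle : ∀ t, g t ≤ g 0 := by
    intro t
    have h := hGD t
    rw [partitionFn_sub_smul_add_smul_one, Complex.re_ofReal_mul] at h
    have h0 : (partitionFn β H).re = f 0 := by
      simp only [hf, zero_smul, add_zero, hA]
      rfl
    rw [h0] at h
    have hexp : Real.exp (-(β * (t ^ 2 * Q / 2))) = e t := by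
      simp only [he, hc]; ring_nf
    rw [hexp] at h
    simpa only [hg, he0, one_mul] using h
  -- `g' = e' f + e f'`, and `g'` is differentiable at `0` with derivative `-2c f(0) + β² Re I`
  set g' : ℝ → ℝ := fun t => e t * (-(c * (2 * t))) * f t + e t * f' t with hg'
  have hgd : ∀ t, HasDerivAt g (g' t) t := fun t => (hed t).mul (hfd t)
  have hg'd : HasDerivAt g' (-(2 * c) * f 0 + β ^ 2 * I.re) 0 := by
    have h1 : HasDerivAt (fun t => e t * (-(c * (2 * t)))) (-(2 * c)) 0 := by
      have hl : HasDerivAt (fun t : ℝ => -(c * (2 * t))) (-(c * 2)) 0 := by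
        have := (((hasDerivAt_id (0 : ℝ)).const_mul 2).const_mul c).neg
        exact this.congr_deriv (by simp)
      refine ((hed 0).mul hl).congr_deriv ?_
      simp [he0]
      ring
    refine ((h1.mul (hfd 0)).add ((hed 0).mul hf'd)).congr_deriv ?_
    simp [he0]
  -- the second-derivative test
  have h2 : -(2 * c) * f 0 + β ^ 2 * I.re ≤ 0 := deriv2_nonpos_of_forall_le hgle hgd hg'd
  -- unfold: `f 0 = Z`, `(V,V) = Re I / Z`
  have hZ : f 0 = ∑ i, Real.exp (-(β * hH.eigenvalues i)) := by
    simp only [hf, zero_smul, add_zero, hA]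
    rw [show exp (-(β : ℂ) • H) = gibbsWeight β H from rfl, ← partitionFn,
      hH.partitionFn_eq_ofReal, Complex.ofReal_re]
  have hZpos : 0 < f 0 := by rw [hZ]; exact hH.sum_exp_pos β
  rw [hH.re_duhamel, ← hI]
  rw [← hZ]
  have h3 : β ^ 2 * I.re ≤ 2 * c * f 0 := by linarith
  have h4 : 2 * c = β * Q := by rw [hc]; ring
  rw [h4] at h3
  -- `β² Re I ≤ βQ Z` ⇒ `Re I / Z ≤ Q/β`
  rw [inv_mul_eq_div, div_le_div_iff₀ hZpos hβ]
  nlinarith [h3, hZpos, hβ]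

end Matrix
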